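import Summits.CriticalPhenomena.PercolationContinuityZ3.Theorems.PercNearOneGluingNoHeavyLowerTailSahiTriangleSupermodular
import Mathlib.Tactic.Linarith
import Mathlib.Tactic.Ring
import Mathlib.Tactic.FieldSimp
import Mathlib.Tactic.LinearCombination
import HarnessLib

/-!
# `NoHeavyLowerTail` (crux stmt-CriticalPhenomena-4575), P2 — **SAHI'S `C_3` ON THE WHOLE TRIANGLE CLASS** (Lean)

Memo SAHI-ROUTE.md §4.27 (seat `prim-masterthm-p2`, gen 8; `--supports stmt-CriticalPhenomena-4575`).  No `sorry`, no named facts, standard axioms.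
Supersedes every earlier class-T stratum of the lane (thin edge at law level, chain–cube–cube, AND/OR/staircase members — `…SahiTriangleStaircaseAll`).

SETTING ("class T", the triangle-block class).  `α, β, γ` finite distributive lattices with FKG probability weights `wA, wB, wC` (log-supermodular,
e.g. product measures on cubes, any law on a chain); `f : γ → α → ℝ`, `g : γ → β → ℝ`, `h : α → β → ℝ` nonnegative and coordinatewise monotone — each
member sees two of the three independent blocks; nothing else is assumed.  For increasing events on a cube this is EVERY triple with no coordinate
essential to all three events.

**THEOREM (`sahiE_three_nonneg_triangle`).  `E_3(f,g,h) ≥ 0`** (Sahi's third functional under the product weight on `α × β × γ`).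

PROOF (one ratio per point of `γ`, three FKG inequalities; SAHI-ROUTE §4.27).  Put `Y(c,b) = E_a[f(c,·)h(·,b)]`, `F_C(c) = E_a f(c,·)`,
`H(b) = E_a h(·,b)`, `G(b) = E_c g(·,b)`, `G_C(c) = E_b g(c,·)`, `Ȳ(c) = E_b Y(c,·)`, `H̄ = E h`, `Ḡ = E g`, and the RATIO `ρ(c) := F_C(c) H̄ / Ȳ(c) ∈ [0,1]`
(FKG on `α` gives `Ȳ(c) ≥ F_C(c) H̄`; `ρ := 1` where `Ȳ = 0`).  EXACT IDENTITY (`sahiE_three_eq`):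
  `E_3 = E_b[Φ] + E_c[ ρ(c)·Cov_b(g(c,·), Y(c,·)) + (1−ρ(c))·Cov_b(G, Y(c,·)) ]`,
  `Φ(b) = E_c[(2−ρ(c)) g(c,b) Y(c,b)] − G(b)·E_c[F_C(c) H(b) + (1−ρ(c)) Y(c,b)]`
(for a general `ρ` the defect is `E_c[(G_C(c) − Ḡ)(ρ(c)Ȳ(c) − F_C(c)H̄)]`, killed pointwise by the ratio).  The covariances are `≥ 0` (FKG on `β`).
`Φ(b) ≥ 0` POINTWISE: with `Ψ(c) = F_C(c)H(b) + (1−ρ(c))Y(c,b)` and `θ(c) = max_{c' ≤ c} Ψ(c')` (monotone, `Ψ ≤ θ ≤ (2−ρ)Y(·,b)` by the MARGIN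
`(2−ρ(c))Y(c,b) ≥ F_C(c')H(b) + (1−ρ(c'))Y(c',b)` for `c' ≤ c`), `E_c[g_b (2−ρ)Y] ≥ E_c[g_b θ] ≥ E_c[g_b]·E_c[θ] ≥ G(b)·E_c[Ψ]` (FKG on `γ`).  The margin
follows from `Y(c,b) ≥ F_C(c)H(b)` (FKG on `α`), `Y(·,b)` monotone, and the ratio condition `(⋆) F_C(c') ≤ (1 − ρ(c) + ρ(c')) F_C(c)` for `c' ≤ c`.
-/

noncomputable section

open scoped Classical

namespace Summit.CriticalPhenomena.PercolationContinuityZ3.Theorems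

namespace SahiTriangleClassT

open Finset
open Literature.Combinatorics.Sahi2008
open SahiChainTriangle (ex_prod3)
open SahiTriangleSupermodular (fkg_sum sum3_bca sum3_cab)

section Defs

variable {α β γ : Type} [Fintype α] [Fintype β] [Fintype γ]
  (wA : α → ℝ) (wB : β → ℝ) (wC : γ → ℝ) (f : γ → α → ℝ) (g : γ → β → ℝ) (h : α → β → ℝ)

/-- `Y(c,b) = E_a[f(c,a) h(a,b)]`. [this work] -/
def Y (c : γ) (b : β) : ℝ := ∑ a, wA a * (f c a * h a b)
/-- `F_C(c) = E_a f(c,a)`. [this work] -/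
def FC (c : γ) : ℝ := ∑ a, wA a * f c a
/-- `H(b) = E_a h(a,b)`. [this work] -/
def HH (b : β) : ℝ := ∑ a, wA a * h a b
/-- `G(b) = E_c g(c,b)`. [this work] -/
def GG (b : β) : ℝ := ∑ c, wC c * g c b
/-- `G_C(c) = E_b g(c,b)`. [this work] -/
def GC (c : γ) : ℝ := ∑ b, wB b * g c b
/-- `Ȳ(c) = E_b Y(c,b)`. [this work] -/
def Ybar (c : γ) : ℝ := ∑ b, wB b * Y wA f h c b
/-- `H̄ = E h`. [this work] -/
def Hbar : ℝ := ∑ b, wB b * HH wA h b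
/-- `Ḡ = E g`. [this work] -/
def Gbar : ℝ := ∑ b, wB b * GG wC g b
/-- The RATIO `ρ(c) = F_C(c) H̄ / Ȳ(c)` (`1` where `Ȳ(c) = 0`). [this work] -/
def rho (c : γ) : ℝ := if Ybar wA wB f h c = 0 then 1 else FC wA f c * Hbar wA wB h / Ybar wA wB f h c
/-- `Ψ_b(c) = F_C(c) H(b) + (1 − ρ(c)) Y(c,b)`. [this work] -/
def Psi (b : β) (c : γ) : ℝ := FC wA f c * HH wA h b + (1 - rho wA wB f h c) * Y wA f h c b
/-- The pointwise kernel `Φ(b) = E_c[(2−ρ) g(·,b) Y(·,b) − G(b) Ψ_b]`. [this work] -/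
def Phi (b : β) : ℝ := ∑ c, wC c * ((2 - rho wA wB f h c) * (g c b * Y wA f h c b) - GG wC g b * Psi wA wB f h b c)

end Defs

section Main

variable {α β γ : Type} [Fintype α] [Fintype β] [Fintype γ]
  {wA : α → ℝ} {wB : β → ℝ} {wC : γ → ℝ} {f : γ → α → ℝ} {g : γ → β → ℝ} {h : α → β → ℝ}

/-! ### Plumbing -/

omit [Fintype α] [Fintype β] [Fintype γ] in
/-- `E[u(c,b) v(a,b) t(c,a)]`-type factorisation: `Σ_a Σ_b Σ_c wA wB wC · u(c,b) v(c,a,b) = Σ_b wB Σ_c wC u(c,b) (Σ_a wA v(c,a,b))`. [folklore] -/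
theorem sum_factor [Fintype α] [Fintype β] [Fintype γ] (wA : α → ℝ) (wB : β → ℝ) (wC : γ → ℝ) (u : γ → β → ℝ) (v : γ → α → β → ℝ) :
    (∑ a, ∑ b, ∑ c, wA a * wB b * wC c * (u c b * v c a b)) = ∑ b, wB b * ∑ c, wC c * (u c b * ∑ a, wA a * v c a b) := by
  rw [sum3_bca]
  refine sum_congr rfl fun b _ => ?_
  rw [mul_sum]
  refine sum_congr rfl fun c _ => ?_
  rw [mul_sum, mul_sum, mul_sum]
  exact sum_congr rfl fun a _ => by ring

omit [Fintype α] [Fintype β] [Fintype γ] in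
/-- Swapping a `b`-sum and a `c`-sum with the weights pulled along. [folklore] -/
theorem swap_bc [Fintype β] [Fintype γ] (wB : β → ℝ) (wC : γ → ℝ) (F : β → γ → ℝ) :
    (∑ b, wB b * ∑ c, wC c * F b c) = ∑ c, wC c * ∑ b, wB b * F b c := by
  simp only [mul_sum]
  rw [sum_comm]
  exact sum_congr rfl fun c _ => sum_congr rfl fun b _ => by ring

omit [Fintype α] [Fintype β] [Fintype γ] in
/-- Pulling a constant out of a weighted sum. [folklore] -/
theorem pull [Fintype β] (wB : β → ℝ) (S : ℝ) (u : β → ℝ) : (∑ b, wB b * (u b * S)) = S * ∑ b, wB b * u b := by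
  rw [mul_sum]; exact sum_congr rfl fun b _ => by ring

omit [Fintype α] [Fintype β] [Fintype γ] in
/-- The bookkeeping identity behind `sahiE_three_eq` (finite sums of reals; uses only `r_c vb_c = q_c Hb` per point). [this work] -/
theorem csum_identity (w SY SGY q vb r gc : γ → ℝ) (SGH Gb Hb : ℝ) (hk : ∀ c, r c * vb c = q c * Hb) (s : Finset γ) :
    2 * (∑ c ∈ s, w c * SY c) + (∑ c ∈ s, w c * q c) * Gb * Hb -
        ((∑ c ∈ s, w c * q c) * SGH + Gb * (∑ c ∈ s, w c * vb c) + Hb * ∑ c ∈ s, w c * (q c * gc c)) =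
      (∑ c ∈ s, w c * ((2 - r c) * SY c - q c * SGH - (1 - r c) * SGY c)) +
        ∑ c ∈ s, w c * (r c * (SY c - gc c * vb c) + (1 - r c) * (SGY c - Gb * vb c)) := by
  induction s using Finset.induction_on with
  | empty => simp
  | insert a s ha ih =>
    simp only [sum_insert ha]
    linear_combination ih + w a * (gc a - Gb) * hk a

/-- The seven moments of `(f,g,h)` in terms of `Y, F_C, H, G` (needs only `Σ wA = Σ wB = Σ wC = 1`). [this work] -/
theorem expectations (hA1 : ∑ a, wA a = 1) (hB1 : ∑ b, wB b = 1) (hC1 : ∑ c, wC c = 1) :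
    ex (fun q : α × β × γ => wA q.1 * wB q.2.1 * wC q.2.2)
        ((fun q => f q.2.2 q.1) * (fun q => g q.2.2 q.2.1) * fun q => h q.1 q.2.1) = ∑ c, wC c * ∑ b, wB b * (g c b * Y wA f h c b) ∧
    ex (fun q : α × β × γ => wA q.1 * wB q.2.1 * wC q.2.2) ((fun q => f q.2.2 q.1) * fun q => g q.2.2 q.2.1) =
      ∑ c, wC c * (FC wA f c * GC wB g c) ∧
    ex (fun q : α × β × γ => wA q.1 * wB q.2.1 * wC q.2.2) ((fun q => f q.2.2 q.1) * fun q => h q.1 q.2.1) = ∑ c, wC c * Ybar wA wB f h c ∧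
    ex (fun q : α × β × γ => wA q.1 * wB q.2.1 * wC q.2.2) (fun q => f q.2.2 q.1) = ∑ c, wC c * FC wA f c ∧
    ex (fun q : α × β × γ => wA q.1 * wB q.2.1 * wC q.2.2) ((fun q => g q.2.2 q.2.1) * fun q => h q.1 q.2.1) =
      ∑ b, wB b * (GG wC g b * HH wA h b) ∧
    ex (fun q : α × β × γ => wA q.1 * wB q.2.1 * wC q.2.2) (fun q => g q.2.2 q.2.1) = Gbar wB wC g ∧
    ex (fun q : α × β × γ => wA q.1 * wB q.2.1 * wC q.2.2) (fun q => h q.1 q.2.1) = Hbar wA wB h := by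
  refine ⟨?_, ?_, ?_, ?_, ?_, ?_, ?_⟩
  · have e : ((fun q : α × β × γ => f q.2.2 q.1) * (fun q => g q.2.2 q.2.1) * fun q => h q.1 q.2.1) =
        fun q => g q.2.2 q.2.1 * (f q.2.2 q.1 * h q.1 q.2.1) := by ext q; simp only [Pi.mul_apply]; ring
    rw [e, ex_prod3, sum_factor wA wB wC g (fun c a b => f c a * h a b)]
    exact swap_bc wB wC (fun b c => g c b * Y wA f h c b)
  · have e : ((fun q : α × β × γ => f q.2.2 q.1) * fun q => g q.2.2 q.2.1) = fun q => g q.2.2 q.2.1 * f q.2.2 q.1 := by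
      ext q; simp only [Pi.mul_apply]; ring
    rw [e, ex_prod3, sum_factor wA wB wC g (fun c a _ => f c a), swap_bc wB wC (fun b c => g c b * ∑ a, wA a * f c a)]
    refine sum_congr rfl fun c _ => ?_
    unfold FC GC
    rw [pull wB (∑ a, wA a * f c a) (g c)]
  · have e : ((fun q : α × β × γ => f q.2.2 q.1) * fun q => h q.1 q.2.1) =
        fun q => (fun (_ : γ) (_ : β) => (1 : ℝ)) q.2.2 q.2.1 * (f q.2.2 q.1 * h q.1 q.2.1) := by ext q; simp only [Pi.mul_apply, one_mul]
    rw [e, ex_prod3, sum_factor wA wB wC (fun _ _ => (1 : ℝ)) (fun c a b => f c a * h a b)]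
    simp only [one_mul]
    exact swap_bc wB wC (fun b c => ∑ a, wA a * (f c a * h a b))
  · have e : (fun q : α × β × γ => f q.2.2 q.1) = fun q => (fun (_ : γ) (_ : β) => (1 : ℝ)) q.2.2 q.2.1 * ((fun c a (_ : β) => f c a) q.2.2 q.1 q.2.1) := by
      ext q; simp only [one_mul]
    rw [e, ex_prod3, sum_factor wA wB wC (fun _ _ => (1 : ℝ)) (fun c a _ => f c a)]
    unfold FC
    simp only [one_mul]
    rw [← sum_mul, hB1, one_mul]
  · have e : ((fun q : α × β × γ => g q.2.2 q.2.1) * fun q => h q.1 q.2.1) =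
        fun q => g q.2.2 q.2.1 * ((fun (_ : γ) a b => h a b) q.2.2 q.1 q.2.1) := by ext q; simp only [Pi.mul_apply]
    rw [e, ex_prod3, sum_factor wA wB wC g (fun _ a b => h a b)]
    unfold GG HH
    refine sum_congr rfl fun b _ => ?_
    rw [sum_mul]
    congr 1
    exact sum_congr rfl fun c _ => by ring
  · have e : (fun q : α × β × γ => g q.2.2 q.2.1) = fun q => g q.2.2 q.2.1 * ((fun (_ : γ) (_ : α) (_ : β) => (1 : ℝ)) q.2.2 q.1 q.2.1) := by
      ext q; simp only [mul_one]
    rw [e, ex_prod3, sum_factor wA wB wC g (fun _ _ _ => (1 : ℝ))]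
    unfold Gbar GG
    refine sum_congr rfl fun b _ => ?_
    simp only [mul_one, hA1]
  · have e : (fun q : α × β × γ => h q.1 q.2.1) = fun q => (fun (_ : γ) (_ : β) => (1 : ℝ)) q.2.2 q.2.1 * ((fun (_ : γ) a b => h a b) q.2.2 q.1 q.2.1) := by
      ext q; simp only [one_mul]
    rw [e, ex_prod3, sum_factor wA wB wC (fun _ _ => (1 : ℝ)) (fun _ a b => h a b)]
    unfold Hbar HH
    refine sum_congr rfl fun b _ => ?_
    simp only [one_mul, ← sum_mul, hC1]

/-! ### FKG facts and the ratio -/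

omit [Fintype β] [Fintype γ] in
/-- `Y(c,b) ≥ F_C(c) H(b)` (FKG on `α`). [this work] -/
theorem FH_le_Y [DistribLattice α] (hA : IsFKGMeasure wA) (hf0 : ∀ c a, 0 ≤ f c a) (hh0 : ∀ a b, 0 ≤ h a b)
    (hfa : ∀ c, Monotone (f c)) (hha : ∀ b, Monotone (fun a => h a b)) (c : γ) (b : β) :
    FC wA f c * HH wA h b ≤ Y wA f h c b := by
  unfold FC HH Y
  exact fkg_sum hA (hf0 c) (fun a => hh0 a b) (hfa c) (hha b)

omit [Fintype γ] in
/-- `Ȳ(c) ≥ F_C(c) H̄`. [this work] -/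
theorem FHbar_le_Ybar [DistribLattice α] (hA : IsFKGMeasure wA) (hB0 : ∀ b, 0 ≤ wB b) (hf0 : ∀ c a, 0 ≤ f c a)
    (hh0 : ∀ a b, 0 ≤ h a b) (hfa : ∀ c, Monotone (f c)) (hha : ∀ b, Monotone (fun a => h a b)) (c : γ) :
    FC wA f c * Hbar wA wB h ≤ Ybar wA wB f h c := by
  unfold Hbar Ybar
  rw [mul_sum]
  refine sum_le_sum fun b _ => ?_
  have := FH_le_Y hA hf0 hh0 hfa hha c b
  have hb := hB0 b
  nlinarith

omit [Fintype γ] in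
/-- The ratio satisfies `ρ(c) Ȳ(c) = F_C(c) H̄`, `0 ≤ ρ ≤ 1`, and `ρ(c) = 1` where `Ȳ(c) = 0`. [this work] -/
theorem rho_spec [DistribLattice α] (hA : IsFKGMeasure wA) (hB0 : ∀ b, 0 ≤ wB b) (hf0 : ∀ c a, 0 ≤ f c a)
    (hh0 : ∀ a b, 0 ≤ h a b) (hfa : ∀ c, Monotone (f c)) (hha : ∀ b, Monotone (fun a => h a b)) (c : γ) :
    rho wA wB f h c * Ybar wA wB f h c = FC wA f c * Hbar wA wB h ∧ 0 ≤ rho wA wB f h c ∧ rho wA wB f h c ≤ 1 ∧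
      (Ybar wA wB f h c = 0 → rho wA wB f h c = 1) := by
  have hFH : 0 ≤ FC wA f c * Hbar wA wB h :=
    mul_nonneg (sum_nonneg fun a _ => mul_nonneg (hA.nonneg a) (hf0 c a))
      (sum_nonneg fun b _ => mul_nonneg (hB0 b) (sum_nonneg fun a _ => mul_nonneg (hA.nonneg a) (hh0 a b)))
  have hle := FHbar_le_Ybar hA hB0 hf0 hh0 hfa hha c
  by_cases hV : Ybar wA wB f h c = 0
  · have h0 : FC wA f c * Hbar wA wB h = 0 := le_antisymm (by rw [← hV]; exact hle) hFH
    simp [rho, hV, h0]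
  · have hVpos : 0 < Ybar wA wB f h c := lt_of_le_of_ne (le_trans hFH hle) (Ne.symm hV)
    simp only [rho, hV, if_false]
    exact ⟨by field_simp, div_nonneg hFH hVpos.le, (div_le_one hVpos).mpr hle, fun h0 => False.elim h0⟩

omit [Fintype γ] in
/-- **`(⋆)` for the ratio**: `F_C(c') ≤ (1 − ρ(c) + ρ(c')) F_C(c)` for `c' ≤ c`. [this work] -/
theorem star [DistribLattice α] [Preorder γ] (hA : IsFKGMeasure wA) (hB0 : ∀ b, 0 ≤ wB b) (hf0 : ∀ c a, 0 ≤ f c a)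
    (hh0 : ∀ a b, 0 ≤ h a b) (hfa : ∀ c, Monotone (f c)) (hfc : ∀ a, Monotone (fun c => f c a))
    (hha : ∀ b, Monotone (fun a => h a b)) {c c' : γ} (hcc : c' ≤ c) :
    FC wA f c' ≤ (1 - rho wA wB f h c + rho wA wB f h c') * FC wA f c := by
  have hρ := rho_spec hA hB0 hf0 hh0 hfa hha c
  have hρ' := rho_spec hA hB0 hf0 hh0 hfa hha c'
  have hQ0 : 0 ≤ FC wA f c := sum_nonneg fun a _ => mul_nonneg (hA.nonneg a) (hf0 c a)
  have hQle : FC wA f c' ≤ FC wA f c := sum_le_sum fun a _ => mul_le_mul_of_nonneg_left (hfc a hcc) (hA.nonneg a)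
  have hY0 : ∀ d, 0 ≤ Y wA f h d := fun d =>
    by intro b; exact sum_nonneg fun a _ => mul_nonneg (hA.nonneg a) (mul_nonneg (hf0 d a) (hh0 a b))
  have hVle : Ybar wA wB f h c' ≤ Ybar wA wB f h c :=
    sum_le_sum fun b _ => mul_le_mul_of_nonneg_left
      (sum_le_sum fun a _ => mul_le_mul_of_nonneg_left (mul_le_mul_of_nonneg_right (hfc a hcc) (hh0 a b)) (hA.nonneg a)) (hB0 b)
  have hV'0 : 0 ≤ Ybar wA wB f h c' := sum_nonneg fun b _ => mul_nonneg (hB0 b) (hY0 c' b)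
  have hVQ := FHbar_le_Ybar hA hB0 hf0 hh0 hfa hha c
  by_cases hV : Ybar wA wB f h c = 0
  · have hV' : Ybar wA wB f h c' = 0 := le_antisymm (by rw [← hV]; exact hVle) hV'0
    rw [hρ.2.2.2 hV, hρ'.2.2.2 hV']
    linarith
  · have hVpos : 0 < Ybar wA wB f h c := lt_of_le_of_ne (le_trans hV'0 hVle) (Ne.symm hV)
    have key : FC wA f c' * Ybar wA wB f h c ≤ (1 - rho wA wB f h c + rho wA wB f h c') * FC wA f c * Ybar wA wB f h c := by
      have e1 : (1 - rho wA wB f h c + rho wA wB f h c') * FC wA f c * Ybar wA wB f h c =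
          FC wA f c * Ybar wA wB f h c - FC wA f c * (rho wA wB f h c * Ybar wA wB f h c) +
            rho wA wB f h c' * FC wA f c * Ybar wA wB f h c := by ring
      have e0 : (1 - rho wA wB f h c + rho wA wB f h c') * FC wA f c * Ybar wA wB f h c =
          FC wA f c * Ybar wA wB f h c - FC wA f c * (FC wA f c * Hbar wA wB h) +
            rho wA wB f h c' * FC wA f c * Ybar wA wB f h c := by rw [e1, hρ.1]
      have h2 : rho wA wB f h c' * FC wA f c * Ybar wA wB f h c' ≤ rho wA wB f h c' * FC wA f c * Ybar wA wB f h c :=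
        mul_le_mul_of_nonneg_left hVle (mul_nonneg hρ'.2.1 hQ0)
      have e3 : rho wA wB f h c' * FC wA f c * Ybar wA wB f h c' = FC wA f c * (FC wA f c' * Hbar wA wB h) := by
        rw [← hρ'.1]; ring
      have h4 : 0 ≤ (FC wA f c - FC wA f c') * (Ybar wA wB f h c - FC wA f c * Hbar wA wB h) :=
        mul_nonneg (by linarith) (by linarith)
      have e5 : FC wA f c' * Ybar wA wB f h c + (FC wA f c - FC wA f c') * (Ybar wA wB f h c - FC wA f c * Hbar wA wB h) =
          FC wA f c * Ybar wA wB f h c - FC wA f c * (FC wA f c * Hbar wA wB h) + FC wA f c * (FC wA f c' * Hbar wA wB h) := by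
        ring
      linarith [e0, h2, e3, h4, e5]
    exact le_of_mul_le_mul_right key hVpos

/-! ### The exact identity -/

/-- `Σ_b wB Φ(b)` as a `c`-sum of the point moments. [this work] -/
theorem sum_Phi :
    (∑ b, wB b * Phi wA wB wC f g h b) = ∑ c, wC c * ((2 - rho wA wB f h c) * (∑ b, wB b * (g c b * Y wA f h c b)) -
      FC wA f c * (∑ b, wB b * (GG wC g b * HH wA h b)) - (1 - rho wA wB f h c) * ∑ b, wB b * (GG wC g b * Y wA f h c b)) := by
  unfold Phi
  rw [swap_bc wB wC]
  refine sum_congr rfl fun c _ => ?_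
  congr 1
  have e : (fun b => wB b * ((2 - rho wA wB f h c) * (g c b * Y wA f h c b) - GG wC g b * Psi wA wB f h b c)) = fun b =>
      (2 - rho wA wB f h c) * (wB b * (g c b * Y wA f h c b)) - FC wA f c * (wB b * (GG wC g b * HH wA h b)) -
        (1 - rho wA wB f h c) * (wB b * (GG wC g b * Y wA f h c b)) := by
    ext b; unfold Psi; ring
  rw [show (∑ b, wB b * ((2 - rho wA wB f h c) * (g c b * Y wA f h c b) - GG wC g b * Psi wA wB f h b c)) =
      ∑ b, (fun b => wB b * ((2 - rho wA wB f h c) * (g c b * Y wA f h c b) - GG wC g b * Psi wA wB f h b c)) b from rfl, e]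
  simp only [sum_sub_distrib, ← mul_sum]

/-- **THE EXACT IDENTITY** `E_3 = E_b[Φ] + E_c[ρ Cov_b(g(c,·),Y(c,·)) + (1−ρ) Cov_b(G,Y(c,·))]` (uses only `ρ(c)Ȳ(c) = F_C(c)H̄`). [this work] -/
theorem sahiE_three_eq [DistribLattice α] [DistribLattice β] (hA : IsFKGMeasure wA) (hB : IsFKGMeasure wB)
    (hC1 : ∑ c, wC c = 1) (hf0 : ∀ c a, 0 ≤ f c a) (hh0 : ∀ a b, 0 ≤ h a b) (hfa : ∀ c, Monotone (f c))
    (hha : ∀ b, Monotone (fun a => h a b)) :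
    sahiE (fun q : α × β × γ => wA q.1 * wB q.2.1 * wC q.2.2) 3
        ![fun q => f q.2.2 q.1, fun q => g q.2.2 q.2.1, fun q => h q.1 q.2.1] =
      (∑ c, wC c * ((2 - rho wA wB f h c) * (∑ b, wB b * (g c b * Y wA f h c b)) -
        FC wA f c * (∑ b, wB b * (GG wC g b * HH wA h b)) - (1 - rho wA wB f h c) * ∑ b, wB b * (GG wC g b * Y wA f h c b))) +
      ∑ c, wC c * (rho wA wB f h c * ((∑ b, wB b * (g c b * Y wA f h c b)) - GC wB g c * Ybar wA wB f h c) +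
        (1 - rho wA wB f h c) * ((∑ b, wB b * (GG wC g b * Y wA f h c b)) - Gbar wB wC g * Ybar wA wB f h c)) := by
  obtain ⟨eFGH, eFG, eFH, eF, eGH, eG, eH⟩ := expectations (f := f) (g := g) (h := h) hA.sum_eq_one hB.sum_eq_one hC1
  rw [sahiE_three, eFGH, eFG, eFH, eF, eGH, eG, eH]
  have key : ∀ c, rho wA wB f h c * Ybar wA wB f h c = FC wA f c * Hbar wA wB h :=
    fun c => (rho_spec hA hB.nonneg hf0 hh0 hfa hha c).1
  exact csum_identity wC (fun c => ∑ b, wB b * (g c b * Y wA f h c b)) (fun c => ∑ b, wB b * (GG wC g b * Y wA f h c b))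
    (FC wA f) (Ybar wA wB f h) (rho wA wB f h) (GC wB g) (∑ b, wB b * (GG wC g b * HH wA h b)) (Gbar wB wC g) (Hbar wA wB h)
    key univ

/-! ### The theorem -/

/-- **THEOREM (Sahi's `C_3` on the triangle class).**  `α, β, γ` finite distributive lattices with FKG probability weights `wA, wB, wC`;
`f : γ → α → ℝ`, `g : γ → β → ℝ`, `h : α → β → ℝ` nonnegative and coordinatewise monotone.  Then
`E_3(f,g,h) ≥ 0` under the product weight on `α × β × γ`.  (For increasing events on a cube: every triple with no coordinate essential to
all three events, every product measure.) [this work] -/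
theorem sahiE_three_nonneg_triangle [DistribLattice α] [DistribLattice β] [DistribLattice γ]
    (hA : IsFKGMeasure wA) (hB : IsFKGMeasure wB) (hC : IsFKGMeasure wC)
    (hf0 : ∀ c a, 0 ≤ f c a) (hfa : ∀ c, Monotone (f c)) (hfc : ∀ a, Monotone (fun c => f c a))
    (hg0 : ∀ c b, 0 ≤ g c b) (hgb : ∀ c, Monotone (g c)) (hgc : ∀ b, Monotone (fun c => g c b))
    (hh0 : ∀ a b, 0 ≤ h a b) (hha : ∀ b, Monotone (fun a => h a b)) (hhb : ∀ a, Monotone (h a)) :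
    0 ≤ sahiE (fun q : α × β × γ => wA q.1 * wB q.2.1 * wC q.2.2) 3
        ![fun q => f q.2.2 q.1, fun q => g q.2.2 q.2.1, fun q => h q.1 q.2.1] := by
  rw [sahiE_three_eq hA hB hC.sum_eq_one hf0 hh0 hfa hha, ← sum_Phi]
  have hA0 := hA.nonneg; have hB0 := hB.nonneg; have hC0 := hC.nonneg
  have hρ := fun c => rho_spec hA hB0 hf0 hh0 hfa hha c
  have hY0 : ∀ c b, 0 ≤ Y wA f h c b := fun c b => sum_nonneg fun a _ => mul_nonneg (hA0 a) (mul_nonneg (hf0 c a) (hh0 a b))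
  have hYb : ∀ c, Monotone (Y wA f h c) := fun c b b' hbb =>
    sum_le_sum fun a _ => mul_le_mul_of_nonneg_left (mul_le_mul_of_nonneg_left (hhb a hbb) (hf0 c a)) (hA0 a)
  have hYc : ∀ b, Monotone (fun c => Y wA f h c b) := fun b c c' hcc =>
    sum_le_sum fun a _ => mul_le_mul_of_nonneg_left (mul_le_mul_of_nonneg_right (hfc a hcc) (hh0 a b)) (hA0 a)
  have hF0 : ∀ c, 0 ≤ FC wA f c := fun c => sum_nonneg fun a _ => mul_nonneg (hA0 a) (hf0 c a)
  have hH0 : ∀ b, 0 ≤ HH wA h b := fun b => sum_nonneg fun a _ => mul_nonneg (hA0 a) (hh0 a b)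
  have hG0 : ∀ b, 0 ≤ GG wC g b := fun b => sum_nonneg fun c _ => mul_nonneg (hC0 c) (hg0 c b)
  have hGb : Monotone (GG wC g) := fun b b' hbb => sum_le_sum fun c _ => mul_le_mul_of_nonneg_left (hgb c hbb) (hC0 c)
  -- (1) Φ(b) ≥ 0 pointwise: FKG on γ with the running maximum θ of Ψ_b
  have hPhi : ∀ b, 0 ≤ Phi wA wB wC f g h b := by
    intro b
    -- Ψ ≥ 0 and the margin
    have hPsi0 : ∀ c, 0 ≤ Psi wA wB f h b c := fun c =>
      add_nonneg (mul_nonneg (hF0 c) (hH0 b)) (mul_nonneg (by linarith [(hρ c).2.2.1]) (hY0 c b))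
    have hmargin : ∀ c c', c' ≤ c → Psi wA wB f h b c' ≤ (2 - rho wA wB f h c) * Y wA f h c b := by
      intro c c' hcc
      unfold Psi
      have h1 : (1 - rho wA wB f h c') * Y wA f h c' b ≤ (1 - rho wA wB f h c') * Y wA f h c b :=
        mul_le_mul_of_nonneg_left (hYc b hcc) (by linarith [(hρ c').2.2.1])
      have hc : 0 ≤ 1 - rho wA wB f h c + rho wA wB f h c' := by linarith [(hρ c).2.2.1, (hρ c').2.1]
      have h2 : (1 - rho wA wB f h c + rho wA wB f h c') * (FC wA f c * HH wA h b) ≤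
          (1 - rho wA wB f h c + rho wA wB f h c') * Y wA f h c b := mul_le_mul_of_nonneg_left (FH_le_Y hA hf0 hh0 hfa hha c b) hc
      have h3 : FC wA f c' * HH wA h b ≤ (1 - rho wA wB f h c + rho wA wB f h c') * FC wA f c * HH wA h b :=
        mul_le_mul_of_nonneg_right (star hA hB0 hf0 hh0 hfa hfc hha hcc) (hH0 b)
      nlinarith [h1, h2, h3]
    -- the running maximum θ(c) = max_{c' ≤ c} Ψ(c')
    let θ : γ → ℝ := fun c => ((univ : Finset γ).filter (· ≤ c)).sup' ⟨c, by simp⟩ (Psi wA wB f h b)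
    have hθge : ∀ c, Psi wA wB f h b c ≤ θ c := fun c => le_sup' (Psi wA wB f h b) (by simp)
    have hθle : ∀ c, θ c ≤ (2 - rho wA wB f h c) * Y wA f h c b := fun c =>
      sup'_le _ _ fun c' hc' => hmargin c c' (mem_filter.mp hc').2
    have hθ0 : ∀ c, 0 ≤ θ c := fun c => (hPsi0 c).trans (hθge c)
    have hθmono : Monotone θ := fun c₁ c₂ h12 =>
      sup'_le _ _ fun c' hc' => le_sup' (Psi wA wB f h b) (by
        simp only [mem_filter, mem_univ, true_and] at hc' ⊢; exact hc'.trans h12)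
    -- FKG on γ: E_c[g_b θ] ≥ E_c[g_b] E_c[θ]
    have fkg := fkg_sum hC (fun c => hg0 c b) hθ0 (hgc b) hθmono
    have s1 : (∑ c, wC c * (g c b * θ c)) ≤ ∑ c, wC c * ((2 - rho wA wB f h c) * (g c b * Y wA f h c b)) :=
      sum_le_sum fun c _ => by
        have := mul_le_mul_of_nonneg_left (hθle c) (hg0 c b)
        have hw := hC0 c
        nlinarith
    have s3 : GG wC g b * ∑ c, wC c * Psi wA wB f h b c ≤ GG wC g b * ∑ c, wC c * θ c :=
      mul_le_mul_of_nonneg_left (sum_le_sum fun c _ => mul_le_mul_of_nonneg_left (hθge c) (hC0 c)) (hG0 b)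
    have e : Phi wA wB wC f g h b =
        (∑ c, wC c * ((2 - rho wA wB f h c) * (g c b * Y wA f h c b))) - GG wC g b * ∑ c, wC c * Psi wA wB f h b c := by
      unfold Phi
      rw [mul_sum, ← sum_sub_distrib]
      exact sum_congr rfl fun c _ => by ring
    rw [e, sub_nonneg]
    calc GG wC g b * ∑ c, wC c * Psi wA wB f h b c ≤ GG wC g b * ∑ c, wC c * θ c := s3
      _ = (∑ c, wC c * g c b) * ∑ c, wC c * θ c := by rw [GG]
      _ ≤ ∑ c, wC c * (g c b * θ c) := fkg
      _ ≤ ∑ c, wC c * ((2 - rho wA wB f h c) * (g c b * Y wA f h c b)) := s1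
  -- (2) covariances ≥ 0 (FKG on β)
  have hcov1 : ∀ c, GC wB g c * Ybar wA wB f h c ≤ ∑ b, wB b * (g c b * Y wA f h c b) :=
    fun c => fkg_sum hB (hg0 c) (hY0 c) (hgb c) (hYb c)
  have hcov2 : ∀ c, Gbar wB wC g * Ybar wA wB f h c ≤ ∑ b, wB b * (GG wC g b * Y wA f h c b) :=
    fun c => fkg_sum hB hG0 (hY0 c) hGb (hYb c)
  refine add_nonneg (sum_nonneg fun b _ => mul_nonneg (hB0 b) (hPhi b)) (sum_nonneg fun c _ => mul_nonneg (hC0 c) (add_nonneg ?_ ?_))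
  · exact mul_nonneg (hρ c).2.1 (sub_nonneg.mpr (hcov1 c))
  · exact mul_nonneg (by linarith [(hρ c).2.2.1]) (sub_nonneg.mpr (hcov2 c))

end Main

section Cubes

variable {A B C : Type} [Fintype A] [Fintype B] [Fintype C]

/-- **Three Boolean cubes with product (Bernoulli) measures — the one-arm programme's triangle-block class in full.**  For ARBITRARY
nonnegative coordinatewise monotone `f : 2^C × 2^A → ℝ`, `g : 2^C × 2^B → ℝ`, `h : 2^A × 2^B → ℝ` and any Bernoulli parameters,
`E_3(f,g,h) ≥ 0` under `μ_{p_A} ⊗ μ_{p_B} ⊗ μ_{p_C}`: Kahn's `C_3` for every triple of increasing events with no coordinate essential to all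
three (group the coordinates by which member ignores them). [this work] -/
theorem sahiE_three_nonneg_cubes_triangle (pA : A → unitInterval) (pB : B → unitInterval) (pC : C → unitInterval)
    (f : Set C → Set A → ℝ) (g : Set C → Set B → ℝ) (h : Set A → Set B → ℝ)
    (hf0 : ∀ c a, 0 ≤ f c a) (hfa : ∀ c, Monotone (f c)) (hfc : ∀ a, Monotone (fun c => f c a))
    (hg0 : ∀ c b, 0 ≤ g c b) (hgb : ∀ c, Monotone (g c)) (hgc : ∀ b, Monotone (fun c => g c b))
    (hh0 : ∀ a b, 0 ≤ h a b) (hha : ∀ b, Monotone (fun a => h a b)) (hhb : ∀ a, Monotone (h a)) :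
    0 ≤ sahiE (fun q : Set A × Set B × Set C =>
        bernoulliWeight pA q.1 * bernoulliWeight pB q.2.1 * bernoulliWeight pC q.2.2) 3
        ![fun q => f q.2.2 q.1, fun q => g q.2.2 q.2.1, fun q => h q.1 q.2.1] :=
  sahiE_three_nonneg_triangle (isFKGMeasure_bernoulliWeight pA) (isFKGMeasure_bernoulliWeight pB) (isFKGMeasure_bernoulliWeight pC)
    hf0 hfa hfc hg0 hgb hgc hh0 hha hhb

end Cubes

end SahiTriangleClassT

end Summit.CriticalPhenomena.PercolationContinuityZ3.Theorems
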